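import Literature.Topology.FourManifolds.ClosedBall
import Literature.Topology.FourManifolds.SliceCharts
import Literature.Topology.FourManifolds.CollarCriterion
import HarnessLib

/-!
# Discharge of `isSmoothEmbedding_closedBallCollarMap`: the radial collar of `∂𝔻ⁿ⁺²` is a smooth embedding

Sibling proof file of `Literature/Topology/FourManifolds/ClosedBall.lean`, proving its named fact
`Literature.Topology.FourManifolds.isSmoothEmbedding_closedBallCollarMap n` (for every `n`): the
radial collar map `closedBallCollarMap (n + 1) : 𝕊ⁿ⁺¹ × [0, 1] → 𝔻ⁿ⁺²`, `(x, t) ↦ (1 - t/2) • x`,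
is a smooth embedding in Mathlib's sense (`Manifold.IsSmoothEmbedding`) for the product model with
corners `(𝓡 (n + 1)).prod (𝓡∂ 1)` on the source and the half-space model `𝓡∂ (n + 2)` of the
manifold-with-boundary structure `instChartedSpaceClosedBall` on the target. This feeds the
explicit collar `closedBallCollar n` / `nonempty_collar_closedBallBoundaryData n` of
`ClosedBall.lean`, the model case (`M = 𝔻ⁿ⁺²`) of the collaring theorem.

## Source

M. W. Hirsch, *Differential Topology*, GTM 33, Springer (1976), Ch. 4, §6 ("Collars and Tubular
Neighborhoods of Neat Submanifolds"), Thm. 6.1, p. 113: *`∂M` has a collar*, a collar being an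
embedding `f : ∂M × [0, ∞) → M` with `f (x, 0) = x`. For the closed ball the collar is explicit
(radial), with parameter interval `[0, 1]` as in
`Literature.Topology.FourManifolds.BoundaryData.Collar`; the content of this file is the
verification, in Mathlib's chart-based formalism of immersions, that this explicit map is a
smooth embedding.

## Proof

*Topological embedding.* `closedBallCollarMap` is continuous and injective (`ClosedBall.lean`),
its source is compact and its target Hausdorff, so it is a closed embedding
(`Continuous.isClosedEmbedding`).

*Immersion* (`Manifold.IsImmersionOfComplement Unit`, i.e. in suitable charts of the maximal
atlases the map *is* a linear isomorphism `(ℝⁿ⁺¹ × ℝ¹) × Unit ≃L ℝⁿ⁺²`). Fix `(x, t)` and let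
`σ = stereographic' (n + 1) (-x)` (Mathlib's `chartAt x`, with `σ x = 0`). In the boundary chart
`closedBallBoundaryChart x` of `𝔻ⁿ⁺²` (coordinates `(1 - ‖y‖, σ (y/‖y‖))`) the collar point
`(1 - t/2) • y` has coordinates `(t/2, σ y)` (`coe_closedBallBoundaryChart_closedBallCollarMap`).
* `t < 1` (`isImmersionAtOfComplement_closedBallCollarMap_of_lt_one`): in the atlas charts
  `σ × IccLeftChart 0 1` (coordinates `(w, s)`, `s₀ = t`) and `closedBallBoundaryChart x` the
  collar map reads `(w, s) ↦ (s₀ / 2, w)` (`collarEquivBot`), on the whole chart target.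
* `t = 1`, the top of the collar, a corner of the source mapped to the *interior* point `x / 2`
  (`isImmersionAtOfComplement_closedBallCollarMap_of_eq_one`): in the atlas charts
  `σ × IccRightChart 0 1` (`s₀ = 1 - t`) and `closedBallBoundaryChart x` the map reads
  `(w, s) ↦ ((1 - s₀)/2, w)`, which is affine but not linear, and no linear form is possible with
  a domain chart sending `(x, 1)` to `0`. This is exactly the situation of the top chart of a
  general collar in `CollarCriterion.lean` (`BoundaryData.OpenCollarData.topChart`), and we use
  its devices: the sphere chart is translated by `e₀` (`BoundaryData.translChart σ e₀`, so
  `(x, 1) ↦ (e₀, 0)`; domain chart `collarTopDomChart`), and the boundary chart is post-composed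
  with the affine automorphism `A : z ↦ (z₁ + 2 z₀, z₁ + 1, z₂, …)` of `ℝⁿ⁺²`
  (`collarCornerHomeomorph`; codomain chart `collarTopCodChart`); then the map reads
  `(w, s) ↦ (w₀ - s₀, w) = (⟪e₀, w⟫ - s₀, w)`, the linear isomorphism
  `BoundaryData.collarConsR n e₀` of `CollarCriterion.lean`. Since `A` does not preserve the
  half-space, the modified chart is `closedBallBoundaryChart x ≫ₕ conjModel (𝓡∂ (n + 2)) A`
  with the conjugated model chart `OpenPartialHomeomorph.conjModel` of `SliceCharts.lean`
  (defined where the point and its image are *interior* points of the model range), which lies in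
  `contDiffGroupoid ∞` (`OpenPartialHomeomorph.conjModel_mem_contDiffGroupoid`) so that the
  composite stays in the maximal atlas (`StructureGroupoid.trans_mem_maximalAtlas`, also
  `SliceCharts.lean`). The domain chart is restricted to the (open) preimage of the codomain
  source, on which the written-in-charts identity is checked pointwise from the explicit
  formulas.

## Design

* Only the two immersion charts are specific to this file; the chart devices are those of
  `SliceCharts.lean` (`conjModel`, `trans_mem_maximalAtlas`) and `CollarCriterion.lean`
  (`translChart`, `coordOne`, `collarConsR`, `iccLeftChart_mem_maximalAtlas`,
  `iccRightChart_mem_maximalAtlas`), and the linear algebra is `BoundaryManifold.consCLE` of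
  `Cobordism.lean`.
* The general criterion `BoundaryData.OpenCollarData.isSmoothEmbedding_collarMap` of
  `CollarCriterion.lean` is *not* invoked: feeding it the radial collar would require the
  `ContMDiffOn` statements for the open radial collar, the radial projection and the height
  `2 (1 - ‖z‖)` as maps into and out of the manifold with boundary `𝔻ⁿ⁺²`, i.e. the closed-ball
  smooth-map interface of the downstream `ClosedBallSmoothMaps.lean`; the direct two-chart
  computation below needs only the explicit charts of `ClosedBall.lean`.
* `σ x = 0` is proved inline (Mathlib's `stereographic'_neg` is `private`; the tree's named
  version is `stereographic'_neg_apply_self` of `StereographicInversion.lean`, not imported here);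
  `modelWithCornersEuclideanHalfSpace_symm_apply_of_nonneg` restates, for `[NeZero m]`, the lemma
  `modelWithCornersEuclideanHalfSpace_symm_apply` of the downstream `ClosedBallHandles.lean`.
* Nothing here changes `ClosedBall.lean`; the fact stays a `def` and consumers feed
  `isSmoothEmbedding_closedBallCollarMap_holds n` to the hypothesis
  `(h : isSmoothEmbedding_closedBallCollarMap n)` of `closedBallCollar` /
  `nonempty_collar_closedBallBoundaryData`.

## References

* M. W. Hirsch, *Differential Topology*, GTM 33, Springer (1976), Ch. 4 §6, Thm. 6.1 (p. 113).
* J. M. Lee, *Introduction to Smooth Manifolds*, 2nd ed., GTM 218 (2013), Thm. 9.25 (collar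
  neighbourhood theorem), Problem 1-11 (`𝔹̄ⁿ`).
-/

open scoped Manifold ContDiff Topology RealInnerProductSpace
open Set Function Metric WithLp

noncomputable section

namespace Literature.Topology.FourManifolds

/-- Local notation: `𝔼 n` is the model Euclidean space `EuclideanSpace ℝ (Fin n)`. -/
local notation "𝔼 " n:arg => EuclideanSpace ℝ (Fin n)

/-- Local notation: `𝕊 n` is the unit sphere in `EuclideanSpace ℝ (Fin (n + 1))` (a `Set`,
used as a type through the coercion). -/
local notation "𝕊 " n:arg => (Metric.sphere (0 : EuclideanSpace ℝ (Fin (n + 1))) 1)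

/-- Local notation: `𝔻 n` is the closed unit ball in `EuclideanSpace ℝ (Fin n)` (a `Set`, used
as a type through the coercion). -/
local notation "𝔻 " n:arg => (Metric.closedBall (0 : EuclideanSpace ℝ (Fin n)) 1)

attribute [local instance] fact_finrank_euclideanSpace_succ

variable (n : ℕ)

/-! ### Linear algebra and the affine straightening map -/

/-- The linear isomorphism `ℝⁿ⁺¹ × ℝ¹ ≃L ℝⁿ⁺²`, `(w, s) ↦ (s₀ / 2, w)`: the `equiv` of Mathlib's
immersion property for the radial collar away from its top (`BoundaryData.collarConsL n` of
`CollarCriterion.lean` up to the factor `1/2` coming from `(x, t) ↦ (1 - t/2) • x`), assembled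
from `BoundaryManifold.consCLE` and `BoundaryData.coordOne`. [folklore] -/
def collarEquivBot : (𝔼 (n + 1) × 𝔼 1) ≃L[ℝ] 𝔼 (n + 2) :=
  ((ContinuousLinearEquiv.refl ℝ (𝔼 (n + 1))).prodCongr
    (BoundaryData.coordOne.trans (ContinuousLinearEquiv.unitsEquivAut ℝ
      (Units.mk0 (2⁻¹ : ℝ) (inv_ne_zero two_ne_zero))))).trans
    (BoundaryManifold.consCLE (n + 1))

/-- `collarEquivBot n (w, s) = consCLE (n + 1) (w, s₀ · 2⁻¹)` (definitional). [folklore] -/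
@[simp]
theorem collarEquivBot_apply (q : 𝔼 (n + 1) × 𝔼 1) :
    collarEquivBot n q = BoundaryManifold.consCLE (n + 1) (q.1, q.2 0 * 2⁻¹) := rfl

/-- The affine automorphism `z ↦ (z₁ + 2 z₀, z₁ + 1, z₂, …, zₙ₊₁)` of `ℝⁿ⁺²` (as a homeomorphism)
used to straighten the codomain chart at the top of the collar. [folklore] -/
def collarCornerHomeomorph : 𝔼 (n + 2) ≃ₜ 𝔼 (n + 2) where
  toFun z := toLp 2 (Fin.cons (z 1 + 2 * z 0)
    (fun i : Fin (n + 1) => z i.succ + closedBallBaseVector n i) : Fin (n + 2) → ℝ)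
  invFun z := toLp 2 (Fin.cons ((z 0 - z 1 + 1) / 2)
    (fun i : Fin (n + 1) => z i.succ - closedBallBaseVector n i) : Fin (n + 2) → ℝ)
  left_inv z := by
    ext i
    refine Fin.cases ?_ (fun j => ?_) i
    · simp
    · simp
  right_inv z := by
    ext i
    refine Fin.cases ?_ (fun j => ?_) i
    · simp; ring
    · simp
  continuous_toFun := by fun_prop
  continuous_invFun := by fun_prop

/-- `collarCornerHomeomorph n z = (z₁ + 2 z₀, z₁ + 1, z₂, …, zₙ₊₁)` (definitional). [folklore] -/
@[simp]
theorem collarCornerHomeomorph_apply (z : 𝔼 (n + 2)) :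
    collarCornerHomeomorph n z = toLp 2 (Fin.cons (z 1 + 2 * z 0)
      (fun i : Fin (n + 1) => z i.succ + closedBallBaseVector n i) : Fin (n + 2) → ℝ) := rfl

/-- The affine map `collarCornerHomeomorph n` is smooth. [folklore] -/
theorem contDiff_collarCornerHomeomorph : ContDiff ℝ ∞ (collarCornerHomeomorph n) := by
  refine contDiff_piLp' 2 fun i => ?_
  refine Fin.cases ?_ (fun j => ?_) i
  · simp only [collarCornerHomeomorph_apply, Fin.cons_zero]
    exact (contDiff_piLp_apply 2).add (contDiff_const.mul (contDiff_piLp_apply 2))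
  · simp only [collarCornerHomeomorph_apply, Fin.cons_succ]
    exact (contDiff_piLp_apply 2).add contDiff_const

/-- The inverse affine map `(collarCornerHomeomorph n)⁻¹ : z ↦ ((z₀ - z₁ + 1)/2, z₁ - 1, z₂, …)`
is smooth. [folklore] -/
theorem contDiff_collarCornerHomeomorph_symm : ContDiff ℝ ∞ (collarCornerHomeomorph n).symm := by
  refine contDiff_piLp' 2 fun i => ?_
  refine Fin.cases ?_ (fun j => ?_) i
  · change ContDiff ℝ ∞ fun z : 𝔼 (n + 2) => (z 0 - z 1 + 1) / 2
    exact (((contDiff_piLp_apply 2 (i := 0)).sub (contDiff_piLp_apply 2 (i := 1))).add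
      contDiff_const).div_const _
  · change ContDiff ℝ ∞ fun z : 𝔼 (n + 2) => z j.succ - closedBallBaseVector n j
    exact (contDiff_piLp_apply 2).sub contDiff_const

variable {n}

/-! ### The radial collar map in the boundary charts -/

/-- The direction of the collar point `(1 - t/2) • y` is `y`. [folklore] -/
theorem norm_inv_smul_coe_closedBallCollarMap (q : (𝕊 n) × Set.Icc (0 : ℝ) 1) :
    ‖(closedBallCollarMap n q : 𝔼 (n + 1))‖⁻¹ • (closedBallCollarMap n q : 𝔼 (n + 1)) =
      (q.1 : 𝔼 (n + 1)) := by
  have ht : (0 : ℝ) < 1 - (q.2 : ℝ) / 2 := by linarith [q.2.2.2]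
  rw [norm_coe_closedBallCollarMap, coe_closedBallCollarMap, smul_smul, inv_mul_cancel₀ ht.ne',
    one_smul]

/-- A collar point `(1 - t/2) • y` with `y ≠ -x` lies in the source of the boundary chart at `x`.
[folklore] -/
theorem closedBallCollarMap_mem_closedBallBoundaryChart_source {x y : 𝕊 n} (h : y ≠ -x)
    (t : Set.Icc (0 : ℝ) 1) :
    closedBallCollarMap n (y, t) ∈ (closedBallBoundaryChart x).source := by
  have ht : (0 : ℝ) < 1 - (t : ℝ) / 2 := by linarith [t.2.2]
  refine ⟨smul_ne_zero ht.ne' (ne_zero_of_mem_unit_sphere y), ?_⟩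
  rw [norm_inv_smul_coe_closedBallCollarMap, ← coe_neg_sphere]
  exact fun h' => h (Subtype.ext h')

/-- **The radial collar map in the boundary chart at `x`**: the point `(1 - t/2) • y` has
coordinates `(t / 2, σ y)`, `σ = stereographic' n (-x)`. [folklore] -/
theorem coe_closedBallBoundaryChart_closedBallCollarMap (x y : 𝕊 n) (t : Set.Icc (0 : ℝ) 1) :
    (closedBallBoundaryChart x (closedBallCollarMap n (y, t))).val =
      toLp 2 (Fin.cons ((t : ℝ) / 2) (ofLp (stereographic' n (-x) y)) : Fin (n + 1) → ℝ) := by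
  have ht : (0 : ℝ) < 1 - (t : ℝ) / 2 := by linarith [t.2.2]
  rw [coe_closedBallBoundaryChart_apply, norm_coe_closedBallCollarMap, coe_closedBallCollarMap,
    radialProjection_smul x ht, sub_sub_cancel]

/-- In model coordinates, the inverse of `𝓡∂ m` is the identity on the half-space (the same
statement, for `m = n + 1`, is `modelWithCornersEuclideanHalfSpace_symm_apply` of the downstream
`ClosedBallHandles.lean`). [folklore] -/
theorem modelWithCornersEuclideanHalfSpace_symm_apply_of_nonneg {m : ℕ} [NeZero m] {s : 𝔼 m}
    (hs : 0 ≤ s 0) : (𝓡∂ m).symm s = ⟨s, hs⟩ :=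
  Subtype.ext ((𝓡∂ m).right_inv (show s ∈ range (𝓡∂ m) from ⟨⟨s, hs⟩, rfl⟩))

/-! ### Below the top of the collar -/

/-- **The radial collar map is an immersion away from the top of the collar.** At `(x, t)` with
`t < 1`, in the charts `stereographic' (n + 1) (-x) × IccLeftChart 0 1` and
`closedBallBoundaryChart x` the collar map reads `(w, s) ↦ (s₀ / 2, w)`. [folklore] -/
theorem isImmersionAtOfComplement_closedBallCollarMap_of_lt_one (x : 𝕊 (n + 1))
    (t : Set.Icc (0 : ℝ) 1) (ht : (t : ℝ) < 1) :
    Manifold.IsImmersionAtOfComplement Unit ((𝓡 (n + 1)).prod (𝓡∂ 1)) (𝓡∂ (n + 2)) ∞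
      (closedBallCollarMap (n + 1)) (x, t) := by
  have hx : x ≠ -x := fun h => ne_neg_of_mem_unit_sphere ℝ x h
  have hσa : stereographic' (n + 1) (-x) ∈ atlas (𝔼 (n + 1)) (𝕊 (n + 1)) := ⟨-x, rfl⟩
  refine Manifold.IsImmersionAtOfComplement.mk_of_charts
    ((ContinuousLinearEquiv.prodUnique ℝ _ _).trans (collarEquivBot n))
    ((stereographic' (n + 1) (-x)).prod (IccLeftChart 0 1)) (closedBallBoundaryChart x)
    ?_ ?_ ?_ ?_ ?_ ?_
  · -- `(x, t)` lies in the source of the domain chart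
    rw [OpenPartialHomeomorph.prod_source]
    exact ⟨by simpa using ne_neg_of_mem_unit_sphere ℝ x, ht⟩
  · -- `(1 - t/2) • x` lies in the source of the boundary chart at `x`
    exact closedBallCollarMap_mem_closedBallBoundaryChart_source hx t
  · -- the domain chart is in the maximal atlas (product of atlas charts)
    exact IsManifold.mem_maximalAtlas_prod (IsManifold.subset_maximalAtlas hσa)
      BoundaryData.OpenCollarData.iccLeftChart_mem_maximalAtlas
  · -- the codomain chart is in the atlas `instChartedSpaceClosedBall`
    exact IsManifold.subset_maximalAtlas (mem_insert_of_mem _ (mem_range_self _))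
  · -- the collar maps the source of the domain chart into the source of the codomain chart
    rintro ⟨y, s⟩ hys
    rw [OpenPartialHomeomorph.prod_source, mem_prod, stereographic'_source,
      mem_compl_singleton_iff] at hys
    exact closedBallCollarMap_mem_closedBallBoundaryChart_source hys.1 s
  · -- in these charts the collar map is `(w, s) ↦ (s₀ / 2, w)`
    rintro ⟨w, s⟩ hq
    rw [OpenPartialHomeomorph.extend_target, mem_inter_iff, mem_preimage,
      ModelWithCorners.range_prod, modelWithCorners_prod_coe_symm, Prod.map_apply,
      OpenPartialHomeomorph.prod_target] at hq
    obtain ⟨⟨-, hs⟩, -, hs0⟩ := hq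
    replace hs0 : 0 ≤ s 0 := by
      rw [range_modelWithCornersEuclideanHalfSpace] at hs0
      exact hs0
    rw [modelWithCornersEuclideanHalfSpace_symm_apply_of_nonneg hs0] at hs
    change s 0 < 1 - 0 at hs
    rw [sub_zero] at hs
    set σ := stereographic' (n + 1) (-x) with hσ
    have h1 : ((IccLeftChart 0 1).symm ⟨s, hs0⟩ : ℝ) = s 0 := by
      change min (s 0 + 0) 1 = s 0
      rw [add_zero, min_eq_left hs.le]
    have h3 : σ (σ.symm w) = w := σ.right_inv (by simp [hσ])
    change (closedBallBoundaryChart x (closedBallCollarMap (n + 1)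
      (σ.symm w, (IccLeftChart 0 1).symm ((𝓡∂ 1).symm s)))).val = collarEquivBot n (w, s)
    rw [modelWithCornersEuclideanHalfSpace_symm_apply_of_nonneg hs0,
      coe_closedBallBoundaryChart_closedBallCollarMap, h1, h3, collarEquivBot_apply]
    ext i
    refine Fin.cases ?_ (fun j => ?_) i
    · simp [div_eq_mul_inv]
    · simp

/-! ### The charts at the top of the collar -/

variable (n) in
/-- **Codomain chart at the top of the collar**: the boundary chart `closedBallBoundaryChart x` of
`𝔻ⁿ⁺²` followed by the affine automorphism `collarCornerHomeomorph n` of the model, conjugated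
into the half-space model by `OpenPartialHomeomorph.conjModel` (`SliceCharts.lean`; defined on
interior points that stay interior). It is a chart of the maximal atlas of `𝔻ⁿ⁺²` around the
interior point `(1/2) • x` in which the collar map becomes linear in the coordinates of
`collarTopDomChart`. [folklore] -/
def collarTopCodChart (x : 𝕊 (n + 1)) :
    OpenPartialHomeomorph (𝔻 (n + 2)) (EuclideanHalfSpace (n + 2)) :=
  closedBallBoundaryChart x ≫ₕ
    (collarCornerHomeomorph n).toOpenPartialHomeomorph.conjModel (𝓡∂ (n + 2))

/-- The codomain chart at the top of the collar belongs to the maximal atlas of `𝔻ⁿ⁺²`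
(`StructureGroupoid.trans_mem_maximalAtlas` with `OpenPartialHomeomorph.conjModel_mem_contDiffGroupoid`
of `SliceCharts.lean`). [folklore] -/
theorem collarTopCodChart_mem_maximalAtlas (x : 𝕊 (n + 1)) :
    collarTopCodChart n x ∈ IsManifold.maximalAtlas (𝓡∂ (n + 2)) ∞ (𝔻 (n + 2)) :=
  StructureGroupoid.trans_mem_maximalAtlas _
    (IsManifold.subset_maximalAtlas (mem_insert_of_mem _ (mem_range_self _)))
    (OpenPartialHomeomorph.conjModel_mem_contDiffGroupoid
      (contDiff_collarCornerHomeomorph n).contDiffOn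
      (contDiff_collarCornerHomeomorph_symm n).contDiffOn)

/-- On its source, the extended codomain chart at the top of the collar is the boundary chart
followed by the affine map `collarCornerHomeomorph n`. [folklore] -/
theorem collarTopCodChart_extend_apply (x : 𝕊 (n + 1)) {p : 𝔻 (n + 2)}
    (hp : p ∈ (collarTopCodChart n x).source) :
    (collarTopCodChart n x).extend (𝓡∂ (n + 2)) p =
      collarCornerHomeomorph n (closedBallBoundaryChart x p).val :=
  OpenPartialHomeomorph.apply_conjModel_of_mem_source hp.2

/-- Membership in the source of the codomain chart at the top of the collar: `p` is in the source
of the boundary chart at `x`, is an interior point, and stays in the open half-space under the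
affine map. [folklore] -/
theorem mem_collarTopCodChart_source_iff (x : 𝕊 (n + 1)) (p : 𝔻 (n + 2)) :
    p ∈ (collarTopCodChart n x).source ↔ p ∈ (closedBallBoundaryChart x).source ∧
      0 < (closedBallBoundaryChart x p).val 0 ∧
      0 < (collarCornerHomeomorph n (closedBallBoundaryChart x p).val) 0 := by
  rw [collarTopCodChart, OpenPartialHomeomorph.trans_source, mem_inter_iff, mem_preimage,
    OpenPartialHomeomorph.mem_conjModel_source, interior_range_modelWithCornersEuclideanHalfSpace,
    Homeomorph.toOpenPartialHomeomorph_source, Homeomorph.toOpenPartialHomeomorph_apply]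
  simp only [mem_univ, true_and, mem_setOf_eq]
  rfl

variable (n) in
/-- **Domain chart at the top of the collar** (before restriction): the product of the
stereographic chart of `𝕊ⁿ⁺¹` from the pole `-x` translated by `e₀`
(`BoundaryData.translChart` of `CollarCriterion.lean`, so that `x` has the *nonzero* coordinate
`e₀`) with the right chart `t ↦ 1 - t` of `[0, 1]`. [folklore] -/
def collarTopDomChart (x : 𝕊 (n + 1)) : OpenPartialHomeomorph ((𝕊 (n + 1)) × Set.Icc (0 : ℝ) 1)
    (ModelProd (𝔼 (n + 1)) (EuclideanHalfSpace 1)) :=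
  (BoundaryData.translChart (stereographic' (n + 1) (-x)) (closedBallBaseVector n)).prod
    (IccRightChart 0 1)

/-- The domain chart at the top of the collar belongs to the maximal atlas of `𝕊ⁿ⁺¹ × [0, 1]`.
[folklore] -/
theorem collarTopDomChart_mem_maximalAtlas (x : 𝕊 (n + 1)) :
    collarTopDomChart n x ∈
      IsManifold.maximalAtlas ((𝓡 (n + 1)).prod (𝓡∂ 1)) ∞ ((𝕊 (n + 1)) × Set.Icc (0 : ℝ) 1) := by
  have hσa : stereographic' (n + 1) (-x) ∈ atlas (𝔼 (n + 1)) (𝕊 (n + 1)) := ⟨-x, rfl⟩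
  exact IsManifold.mem_maximalAtlas_prod
    (BoundaryData.translChart_mem_maximalAtlas (IsManifold.subset_maximalAtlas hσa) _)
    BoundaryData.OpenCollarData.iccRightChart_mem_maximalAtlas

/-- The source of the domain chart at the top of the collar is `{-x}ᶜ × (0, 1]`. [folklore] -/
theorem collarTopDomChart_source (x : 𝕊 (n + 1)) :
    (collarTopDomChart n x).source = {-x}ᶜ ×ˢ {t : Set.Icc (0 : ℝ) 1 | (0 : ℝ) < t} := by
  change (BoundaryData.translChart (stereographic' (n + 1) (-x)) (closedBallBaseVector n)).source
    ×ˢ (IccRightChart 0 1).source = _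
  rw [BoundaryData.translChart_source, stereographic'_source]
  rfl

/-- The target of the domain chart at the top of the collar (definitional). [folklore] -/
theorem collarTopDomChart_target (x : 𝕊 (n + 1)) : (collarTopDomChart n x).target =
    (BoundaryData.translChart (stereographic' (n + 1) (-x)) (closedBallBaseVector n)).target ×ˢ
      (IccRightChart 0 1).target := rfl

/-- The inverse of the domain chart at the top of the collar: `(w, s) ↦ (σ⁻¹ (w - e₀), 1 - s₀)`
(definitional). [folklore] -/
theorem collarTopDomChart_symm_apply (x : 𝕊 (n + 1)) (w : 𝔼 (n + 1))
    (s : EuclideanHalfSpace 1) : (collarTopDomChart n x).symm (w, s) =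
      ((stereographic' (n + 1) (-x)).symm (w + -closedBallBaseVector n),
        (IccRightChart 0 1).symm s) := rfl

/-- **The radial collar map is an immersion at the top of the collar.** At `(x, 1)`, in the
charts `collarTopDomChart n x` (restricted to the preimage of the codomain source) and
`collarTopCodChart n x`, the collar map reads `(w, s) ↦ (w₀ - s₀, w) = (⟪e₀, w⟫ - s₀, w)`, the
linear isomorphism `BoundaryData.collarConsR n e₀` of `CollarCriterion.lean`. [folklore] -/
theorem isImmersionAtOfComplement_closedBallCollarMap_of_eq_one (x : 𝕊 (n + 1))
    (t : Set.Icc (0 : ℝ) 1) (ht : (t : ℝ) = 1) :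
    Manifold.IsImmersionAtOfComplement Unit ((𝓡 (n + 1)).prod (𝓡∂ 1)) (𝓡∂ (n + 2)) ∞
      (closedBallCollarMap (n + 1)) (x, t) := by
  have hx : x ≠ -x := fun h => ne_neg_of_mem_unit_sphere ℝ x h
  -- the chart from the pole `-x` sends `x` to the origin (Mathlib's `stereographic'_neg` is
  -- private; cf. `stereographic'_neg_apply_self` of `StereographicInversion.lean`)
  have hσx : stereographic' (n + 1) (-x) x = 0 := by
    rw [stereographic'_eq_repr_stereoToFun]
    have : stereoToFun ((-x : 𝕊 (n + 1)) : 𝔼 (n + 2)) (x : 𝔼 (n + 2)) =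
        stereographic (norm_eq_of_mem_sphere (-x)) x := rfl
    rw [this, stereographic_neg_apply, map_zero]
  set U := closedBallCollarMap (n + 1) ⁻¹' (collarTopCodChart n x).source with hU_def
  have hU : IsOpen U :=
    (collarTopCodChart n x).open_source.preimage (continuous_closedBallCollarMap _)
  have hfx : closedBallCollarMap (n + 1) (x, t) ∈ (collarTopCodChart n x).source := by
    rw [mem_collarTopCodChart_source_iff, coe_closedBallBoundaryChart_closedBallCollarMap, ht, hσx]
    refine ⟨closedBallCollarMap_mem_closedBallBoundaryChart_source hx t, ?_, ?_⟩
    · simp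
    · simp
  refine Manifold.IsImmersionAtOfComplement.mk_of_charts
    ((ContinuousLinearEquiv.prodUnique ℝ _ _).trans
      (BoundaryData.collarConsR n (closedBallBaseVector n)))
    ((collarTopDomChart n x).restr U) (collarTopCodChart n x) ?_ hfx ?_
    (collarTopCodChart_mem_maximalAtlas x) ?_ ?_
  · -- `(x, t)` lies in the source of the (restricted) domain chart
    rw [OpenPartialHomeomorph.restr_source, hU.interior_eq, collarTopDomChart_source]
    exact ⟨⟨fun h => hx h, show (0 : ℝ) < t by rw [ht]; exact one_pos⟩, hfx⟩
  · -- the domain chart is in the maximal atlas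
    exact restr_mem_maximalAtlas _ (collarTopDomChart_mem_maximalAtlas x) hU
  · -- by construction the collar maps the restricted source into the codomain source
    rw [OpenPartialHomeomorph.restr_source, hU.interior_eq]
    exact inter_subset_right
  · -- in these charts the collar map is `(w, s) ↦ (w₀ - s₀, w)`
    rintro ⟨w, s⟩ hq
    rw [OpenPartialHomeomorph.extend_target, mem_inter_iff, mem_preimage,
      ModelWithCorners.range_prod, modelWithCorners_prod_coe_symm, Prod.map_apply,
      OpenPartialHomeomorph.restr_target, hU.interior_eq, mem_inter_iff, mem_preimage,
      collarTopDomChart_target] at hq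
    obtain ⟨⟨⟨-, hs⟩, hqU⟩, -, hs0⟩ := hq
    replace hs0 : 0 ≤ s 0 := by
      rw [range_modelWithCornersEuclideanHalfSpace] at hs0
      exact hs0
    rw [modelWithCornersEuclideanHalfSpace_symm_apply_of_nonneg hs0] at hs hqU
    change s 0 < 1 - 0 at hs
    rw [sub_zero] at hs
    set σ := stereographic' (n + 1) (-x) with hσ
    change closedBallCollarMap (n + 1) (σ.symm (w + -closedBallBaseVector n),
      (IccRightChart 0 1).symm ⟨s, hs0⟩) ∈ (collarTopCodChart n x).source at hqU
    have h1 : ((IccRightChart 0 1).symm ⟨s, hs0⟩ : ℝ) = 1 - s 0 := by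
      change max (1 - s 0) 0 = 1 - s 0
      exact max_eq_left (by linarith)
    have h3 : σ (σ.symm (w + -closedBallBaseVector n)) = w + -closedBallBaseVector n :=
      σ.right_inv (by simp [hσ])
    change (collarTopCodChart n x).extend (𝓡∂ (n + 2)) (closedBallCollarMap (n + 1)
      (σ.symm (w + -closedBallBaseVector n), (IccRightChart 0 1).symm ((𝓡∂ 1).symm s))) =
      BoundaryData.collarConsR n (closedBallBaseVector n) (w, s)
    rw [modelWithCornersEuclideanHalfSpace_symm_apply_of_nonneg hs0,
      collarTopCodChart_extend_apply x hqU, coe_closedBallBoundaryChart_closedBallCollarMap, h1,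
      h3, BoundaryData.collarConsR_apply]
    ext i
    refine Fin.cases ?_ (fun j => ?_) i
    · simp [EuclideanSpace.inner_single_left]
      ring
    · simp [Pi.single_apply]

/-! ### Discharge of `isSmoothEmbedding_closedBallCollarMap` -/

variable (n) in
/-- **Discharge of the named fact `isSmoothEmbedding_closedBallCollarMap`**: the radial collar map
`(x, t) ↦ (1 - t/2) • x`, `𝕊ⁿ⁺¹ × [0, 1] → 𝔻ⁿ⁺²`, is a smooth embedding for the models
`(𝓡 (n + 1)).prod (𝓡∂ 1)` and `𝓡∂ (n + 2)` (Mathlib's `Manifold.IsSmoothEmbedding`). Real proof: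
it is a topological (closed) embedding, being a continuous injection from a compact space to a
Hausdorff space, and an immersion with trivial complement `Unit`, because in explicit charts it is
a linear isomorphism `ℝⁿ⁺¹ × ℝ¹ ≃ ℝⁿ⁺²`: away from the top `t = 1`, in
`stereographic' (n + 1) (-x) × IccLeftChart 0 1` and `closedBallBoundaryChart x` it reads
`(w, s) ↦ (s₀ / 2, w)` (`isImmersionAtOfComplement_closedBallCollarMap_of_lt_one`); at the top,
in the translated chart `collarTopDomChart n x` and the straightened boundary chart
`collarTopCodChart n x` it reads `(w, s) ↦ (⟪e₀, w⟫ - s₀, w)`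
(`isImmersionAtOfComplement_closedBallCollarMap_of_eq_one`). This is the explicit model case
(`M = 𝔻ⁿ⁺²`, `∂M = 𝕊ⁿ⁺¹`) of the collaring theorem, Hirsch, *Differential Topology* (1976),
Ch. 4, §6 ("Collars and Tubular Neighborhoods of Neat Submanifolds"), Thm. 6.1, p. 113: *`∂M` has
a collar*, i.e. an embedding `f : ∂M × [0, ∞) → M` with `f (x, 0) = x`; here the collar is the
radial one and the parameter interval is `[0, 1]`. [cite: Hirsch1976, §4.6 Thm 6.1 p 113] -/
theorem isSmoothEmbedding_closedBallCollarMap_holds : isSmoothEmbedding_closedBallCollarMap n := by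
  refine ⟨?_, ((continuous_closedBallCollarMap (n + 1)).isClosedEmbedding
    (injective_closedBallCollarMap (n + 1))).isEmbedding⟩
  refine Manifold.IsImmersionOfComplement.isImmersion (F := Unit) fun q => ?_
  obtain ⟨x, t⟩ := q
  rcases lt_or_eq_of_le t.2.2 with ht | ht
  · exact isImmersionAtOfComplement_closedBallCollarMap_of_lt_one x t ht
  · exact isImmersionAtOfComplement_closedBallCollarMap_of_eq_one x t ht

end Literature.Topology.FourManifolds
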